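import Summits.AtomisticToContinuum.BoseEinsteinCondensation.Theses.BECGroundStateSOS
import Summits.AtomisticToContinuum.BoseEinsteinCondensation.Theses.BECSectorPoincareTwoScale
import Summits.AtomisticToContinuum.BoseEinsteinCondensation.Theses.BECNoCheapMomentum
import Summits.AtomisticToContinuum.BoseEinsteinCondensation.Theorems.PeriodicIRBound.Negative.GroundOccupation
import Literature.MathematicalPhysics.QuantumManyBody.PeriodicBoseGasMomentumSector
import HarnessLib

/-!
# Line `linear-ph-floor-wagner` — checked skeleton for crux `PeriodicIRBound` (stmt-AtomisticToContinuum-3972)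
# (lead's reshaped copy, wave 1)

Route `route-AtomisticToContinuum-BECGroundStateSOS`; crux decl
`Summit.AtomisticToContinuum.BoseEinsteinCondensation.Theses.BECGroundStateSOS.PeriodicIRBound`, concluded BY
NAME by `PeriodicIRBound_of` (§4) as a closed term over the SEVEN registered stubs of §3 (the Defs module's `periodicIRBound_of_inputs` is the same composition with the stubs as hypotheses). Planner's skeleton:
`Cruxes/PeriodicIRBound/Lines/linear-ph-floor-wagner.lean` (6 stubs); lead's reshape (2026-08-16): the planner's
`stub_transfer` (M/L) is split at the skeleton level into `stub_wagnerFeynman` (the analytic heart: the two-sided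
moment bound for `groundOccupation` at fixed `(N,L)`, held by the lead) and `stub_transferArith` (window arithmetic
+ the a.e.-free case), glued by the sorry-free `transfer_of`; all statements are named `Prop`s of §1–§2, which are
byte-identical with the Defs module `Theorems/BECGroundStateSOSPeriodicIRBoundDefs.lean` (proposed; once it lands
the block between the BEGIN/END DEFS markers is replaced by the import). Line card `Lines/linear-ph-floor-wagner.md`;
Disproof `Cruxes/PeriodicIRBound/Disproof.lean` §1–§20 (no kill) honoured as in the card (γ-form target, `∫v = ⊤`
split, δ after N, k ≠ 0, per-v constants).

Stubs (sizes): 1 `stub_landauSectorBound` = stmt-9091 (XL, open, POOLED) · 2 `stub_energyConvexity` = stmt-9094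
(M/open, POOLED) · 3 `stub_zeroMomentumGround` = stmt-11845 (XL Lean, POOLED) · 4 `stub_linearFloor_of_landau :
LinearFloorOfLandau` (S/M, provable now) · 5b `stub_wagnerFeynman : WagnerFeynmanBound` (L/XL Lean, no open
mathematics; LEAD) · 5c `stub_transferArith : TransferArith` (M) · 6 `stub_hardCore : HardCoreHalf` (L/XL, fragile).
-/

noncomputable section

open scoped BigOperators ENNReal
open Filter MeasureTheory

namespace Summit.AtomisticToContinuum.BoseEinsteinCondensation.Cruxes.PeriodicIRBound.LinearPhFloorWagner

open Literature.MathematicalPhysics.QuantumManyBody.BoseGas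
open Summit.AtomisticToContinuum.BoseEinsteinCondensation.Theses.BECGroundStateSOS (PeriodicIRBound)
open Summit.AtomisticToContinuum.BoseEinsteinCondensation.Theses.BECSectorPoincareTwoScale
  (LandauSectorBound EnergyConvexityWindow)
open Summit.AtomisticToContinuum.BoseEinsteinCondensation.Theses.BECNoCheapMomentum
  (ZeroMomentumGround SectorGapFloor)
open Summit.AtomisticToContinuum.BoseEinsteinCondensation.Theorems.PeriodicIRBound.Negative
  (IRBoundFor InWindow groundOccupation GroundIRBoundWith irBoundFor_iff_ground)

-- BEGIN DEFS (byte-identical with Theorems/BECGroundStateSOSPeriodicIRBoundDefs.lean §1–§2)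

/-! ## §1 The transfer target `C⁺` and the per-potential dictionary -/

/-- **`C⁺` for one potential (LINEAR particle–hole sector floor).** For every window constant `C > 0` there
are `θ, ρ₀ > 0` with: for `0 < ρ < ρ₀`, eventually in `N`, for every `k ≠ 0` with `‖k‖² ≤ Cρ`,
`2E₀^per(N,L_N) + 2θ√ρ‖k‖ ≤ E^per_{N+1}(k;L_N) + E^per_{N-1}(k;L_N)`, `L_N = (N/ρ)^{1/3}`,
`E^per_M(k;L) = momentumSectorEnergy v M L k` (`⊤` off the dual lattice `(2π/L_N)ℤ³`, so only lattice momenta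
bind). Verbatim the tail of `BECNoCheapMomentum.SectorGapFloor` (stmt-11843) with the quadratic floor `2κ‖k‖²`
replaced by the linear `2θ√ρ‖k‖` — the weakest floor giving the crux's exponent `1`; `θ = θ(v)` absorbs `√a`.
FALSE for the a.e.-free gas (`Γ_free = 2|k|² + O(1/NL²)`), whence the hypothesis `∫v ≠ 0` in
`LinearParticleHoleFloor`. A statement of the proof plan, not a result in print. -/
def LinearFloorFor (v : ℝ → ℝ≥0∞) : Prop :=
  ∀ C : ℝ, 0 < C → ∃ θ : ℝ, 0 < θ ∧ ∃ ρ₀ : ℝ, 0 < ρ₀ ∧ ∀ ρ : ℝ, 0 < ρ → ρ < ρ₀ →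
    ∀ᶠ N : ℕ in atTop, ∀ k : Space, k ≠ 0 → ‖k‖ ^ 2 ≤ C * ρ →
      2 * periodicGroundStateEnergy v N (sideLength ρ N) +
          ENNReal.ofReal (2 * θ * Real.sqrt ρ * ‖k‖) ≤
        momentumSectorEnergy v (N + 1) (sideLength ρ N) k +
          momentumSectorEnergy v (N - 1) (sideLength ρ N) k

/-- **Global `C⁺`**: the linear particle–hole floor for every repulsive finite-range `v` that is not a.e. zero
(`∫ v(|x|) dx ≠ 0`; hard cores `∫v = ⊤` INCLUDED). By `LinearFloorOfLandau` (stub 4) it follows from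
stmt-9091 ∧ stmt-9094, and by `sectorGapFloor_of_linearParticleHoleFloor` it implies stmt-11843. A statement of the
proof plan (conjecture-level), not a result in print. -/
def LinearParticleHoleFloor : Prop :=
  ∀ v : ℝ → ℝ≥0∞, IsRepulsiveFiniteRange v → (∫⁻ x : Space, v ‖x‖) ≠ 0 → LinearFloorFor v

/-- **Zero-momentum gap at fixed `(N, L)`** for one potential: `E₀^per(N,L) < E^per_N(q;L)` for every `q ≠ 0`
(Perron–Frobenius uniqueness/positivity of the torus ground state). `BECNoCheapMomentum.ZeroMomentumGround`
(stmt-11845) is `∀ v` integrable, `ZeroMomentumGapFor v` — definitionally (`zeroMomentumGround_iff`).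
[cite: CorneanDerezinskiZin2009, §2.7] -/
def ZeroMomentumGapFor (v : ℝ → ℝ≥0∞) : Prop :=
  ∀ (N : ℕ) (L : ℝ), 0 < L → ∀ q : Space, q ≠ 0 →
    periodicGroundStateEnergy v N L < momentumSectorEnergy v N L q

/-- **The crux for one potential in γ-form** (Disproof §11, landed `Negative.GroundOccupation`): for every `κ > 0`
there are `ρ₀, C > 0` with `groundOccupation v N L_N k ≤ C√ρ L_N/‖k‖_∞` for all `k` in the window, eventually in
`N`, for all `ρ < ρ₀` — no slack `δ`, no state quantifier. Equivalent to the crux's `IRBoundFor v` by the landed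
`irBoundFor_iff_ground` (`groundIRBoundFor_iff`). [folklore] -/
def GroundIRBoundFor (v : ℝ → ℝ≥0∞) : Prop :=
  ∀ κ : ℝ, 0 < κ → ∃ ρ₀ : ℝ, 0 < ρ₀ ∧ ∃ C : ℝ, 0 < C ∧ GroundIRBoundWith v κ ρ₀ C

/-- γ-form ↔ crux form, per potential (landed `irBoundFor_iff_ground`). [folklore] -/
theorem groundIRBoundFor_iff (v : ℝ → ℝ≥0∞) : GroundIRBoundFor v ↔ IRBoundFor v :=
  (irBoundFor_iff_ground v).symm

/-- stmt-11845 is, definitionally, `ZeroMomentumGapFor` for every integrable admissible `v`. [folklore] -/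
theorem zeroMomentumGround_iff :
    ZeroMomentumGround ↔ ∀ v : ℝ → ℝ≥0∞, IsRepulsiveFiniteRange v → (∫⁻ x : Space, v ‖x‖) ≠ ⊤ →
      ZeroMomentumGapFor v :=
  Iff.rfl

/-- **Pooling lemma: `C⁺` implies BECNoCheapMomentum's rank-2 crux `SectorGapFloor` (stmt-11843).**
On the window `‖k‖² ≤ Cρ` one has `‖k‖ ≤ √C·√ρ`, so the linear floor `2θ√ρ‖k‖` dominates the quadratic one
`2κ‖k‖²` with `κ := θ/√C`. [folklore] -/
theorem sectorGapFloor_of_linearParticleHoleFloor (h : LinearParticleHoleFloor) : SectorGapFloor := by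
  intro v hv hv0 C hC
  obtain ⟨θ, hθ, ρ₀, hρ₀, hθρ⟩ := h v hv hv0 C hC
  have hCpos : 0 < Real.sqrt C := Real.sqrt_pos.2 hC
  refine ⟨θ / Real.sqrt C, div_pos hθ hCpos, ρ₀, hρ₀, fun ρ hρ hρρ₀ => ?_⟩
  filter_upwards [hθρ ρ hρ hρρ₀] with N hN k hk hkC
  refine le_trans ?_ (hN k hk hkC)
  have hkn : 0 ≤ ‖k‖ := norm_nonneg k
  have hk' : ‖k‖ ≤ Real.sqrt C * Real.sqrt ρ := by
    rw [← Real.sqrt_mul hC.le, ← Real.sqrt_sq hkn]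
    exact Real.sqrt_le_sqrt hkC
  have key : 2 * (θ / Real.sqrt C) * ‖k‖ ^ 2 ≤ 2 * θ * Real.sqrt ρ * ‖k‖ :=
    calc 2 * (θ / Real.sqrt C) * ‖k‖ ^ 2
        = 2 * (θ / Real.sqrt C) * ‖k‖ * ‖k‖ := by ring
      _ ≤ 2 * (θ / Real.sqrt C) * (Real.sqrt C * Real.sqrt ρ) * ‖k‖ := by gcongr
      _ = 2 * θ * Real.sqrt ρ * ‖k‖ := by field_simp
  exact add_le_add le_rfl (ENNReal.ofReal_le_ofReal key)

/-! ## §2 Statements of the line's own stubs -/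

/-- **Stub 4 statement — `EnergyConvexityWindow → LandauSectorBound → C⁺`** (the linear twin of the filed
support item `BECSectorPoincareTwoScale.LandauFloorToSectorGap`, stmt-9096). Plan: for admissible `v` with
`∫v ≠ 0`, `a := scatteringLength v` has `0 < a.toReal` (`LSSY2005_zeroScatteringLength_holds` contrapositive,
`scatteringLength_ne_top_of_finiteRange`); apply stmt-9091 with `M₀ := √(C/a)` at particle numbers `N ± 1` in the
same box `L_N` (density window for `N ≥ 2`), off-lattice `k` give `⊤` (`momentumSectorEnergy_eq_top_of_forall_ne`),
absorb the convexity allowance with `ε := πθ` via `‖k‖ ≥ 2π/L_N`; output `θ' = (3/4)θ√a`. A statement of the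
proof plan, not a result in print. -/
def LinearFloorOfLandau : Prop :=
  EnergyConvexityWindow → LandauSectorBound → LinearParticleHoleFloor

/-- **The Wagner–Feynman moment bound with constant `A`, for one potential, at fixed `(N, L)`**: whenever the
particle–hole sector sum at the dual-lattice momentum `p = 2πk/L` exceeds `2E₀^per(N,L)` by `θ ≥ 0`, the
ground-state occupation `γ_N(k)` (`groundOccupation`, `⨅_δ ⨆_{δ-near-min}`) obeys
`γ_N(k)·θ ≤ A(‖p‖² + N‖v‖₁/L³)`, `‖v‖₁ = ∫ v(|x|)dx` — the two-sided moment inequality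
`n_p Γ_N(p) ≤ ⟨[[a_p,H],a_p†]⟩ = ‖p‖² + L⁻³(v̂(0)N + ∑_q v̂(q-p)n_q) ≤ ‖p‖² + 2N‖v‖₁/L³` for the zero-momentum
part of near-minimisers (`δ → 0` through the zero-momentum gap). [cite: Wagner1966; Stringari1995 §2.2 (16)] -/
def WagnerFeynmanWith (v : ℝ → ℝ≥0∞) (A : ℝ) : Prop :=
  ∀ (N : ℕ) (L : ℝ), 2 ≤ N → 0 < L → periodicGroundStateEnergy v N L ≠ ⊤ →
    ∀ k : Fin 3 → ℤ, k ≠ 0 → ∀ θ : ℝ, 0 ≤ θ →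
      2 * periodicGroundStateEnergy v N L + ENNReal.ofReal θ ≤
          momentumSectorEnergy v (N + 1) L (latticeVec (2 * Real.pi / L) k) +
            momentumSectorEnergy v (N - 1) L (latticeVec (2 * Real.pi / L) k) →
      groundOccupation v N L k * ENNReal.ofReal θ ≤
        ENNReal.ofReal (A * (‖latticeVec (2 * Real.pi / L) k‖ ^ 2 +
          N * (∫⁻ x : Space, v ‖x‖).toReal / L ^ 3))

/-- **Stub 5b statement — the Wagner–Feynman bound** (the line's analytic heart, held by the lead): one absolute
constant `A` serves every INTEGRABLE admissible `v` with the fixed-`(N,L)` zero-momentum gap. Plan: c.o.m. sector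
decomposition of a `δ`-near-minimiser (`∑_{q≠0}‖Ψ_q‖² ≤ δ/g_N`, `g_N > 0` from `ZeroMomentumGapFor` and
`E_N(q) ≥ |q|²/N`), first-quantised `a(φ_p)`, `a†(φ_p)` on the zero-momentum part `Φ`, sector variational bounds
(`momentumSectorEnergy_neg`, `E₀(N) ≤ E₀(N+1)`), the form identity
`Q_{N-1}(aΦ) + Q_{N+1}(a†Φ) = ⟨[[a,H],a†]⟩_Φ + 2Re B(n̂_pΦ,Φ) + Q_N(Φ)` with `|2Re B₀(n̂_pΦ,Φ)| ≤ 2√(δ'K)`,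
`K < ∞` because `v ∈ L¹`; `δ → 0`. [cite: Wagner1966; PitaevskiiStringari1991; CorneanDerezinskiZin2009 §2.7] -/
def WagnerFeynmanBound : Prop :=
  ∃ A : ℝ, 0 < A ∧ ∀ v : ℝ → ℝ≥0∞, IsRepulsiveFiniteRange v → (∫⁻ x : Space, v ‖x‖) ≠ ⊤ →
    ZeroMomentumGapFor v → WagnerFeynmanWith v A

/-- **Stub 5c statement — window arithmetic and the a.e.-free case**: for an integrable admissible `v`, `C⁺`
(when `∫v ≠ 0`) and a Wagner–Feynman bound with some constant `A` give the crux for `v` in γ-form. Plan: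
(i) `∫v = 0`: `v(|·|) = 0` a.e., `periodicEnergy v = periodicEnergy 0` (tree: `periodicEnergy_eq_ofReal_of_ae`),
so `IRBoundFor v ↔ IRBoundFor 0`, true by the landed `irBoundFor_zero`; (ii) `∫v ≠ 0`: fix `κ`; window modes
have `p = 2πk/L_N` with `‖p‖² ≤ 12π²κ²ρ` and `‖p‖ ≥ 2π‖k‖_∞/L_N`; take the floor at `C := 12π²κ²`,
`ρ₀ := min(ρ₀^floor, ρ₁^Ruelle)` (`exists_eventually_periodicGroundStateEnergy_lt_top`), `θ := 2θ₀√ρ‖p‖`, and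
`γ ≤ A(‖p‖² + ρ‖v‖₁)/(2θ₀√ρ‖p‖) ≤ A(π√3κ² + ‖v‖₁/(4π))/θ₀ · √ρL_N/‖k‖_∞` (`L_N³ = N/ρ`,
`1 ≤ κ√ρL_N/‖k‖_∞`). Elementary. -/
def TransferArith : Prop :=
  ∀ v : ℝ → ℝ≥0∞, IsRepulsiveFiniteRange v → (∫⁻ x : Space, v ‖x‖) ≠ ⊤ →
    ((∫⁻ x : Space, v ‖x‖) ≠ 0 → LinearFloorFor v) →
    (∃ A : ℝ, 0 < A ∧ WagnerFeynmanWith v A) → GroundIRBoundFor v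

/-- **The integrable half of the crux** (the card's `stub_transfer`): for an INTEGRABLE admissible `v`, `C⁺` for
`v` (available when `∫v ≠ 0`) and the fixed-`(N,L)` zero-momentum gap give the crux for `v` in γ-form. Derived
from stubs 5b and 5c by `transfer_of`. -/
def Transfer : Prop :=
  ∀ v : ℝ → ℝ≥0∞, IsRepulsiveFiniteRange v → (∫⁻ x : Space, v ‖x‖) ≠ ⊤ →
    ((∫⁻ x : Space, v ‖x‖) ≠ 0 → LinearFloorFor v) → ZeroMomentumGapFor v → GroundIRBoundFor v

/-- `WagnerFeynmanBound → TransferArith → Transfer` (pure logic). [folklore] -/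
theorem transfer_of (h₁ : WagnerFeynmanBound) (h₂ : TransferArith) : Transfer := by
  intro v hv hint hfloor hzmg
  obtain ⟨A, hA, h⟩ := h₁
  exact h₂ v hv hint hfloor ⟨A, hA, h v hv hint hzmg⟩

/-- **Stub 6 statement — the NON-INTEGRABLE half** (`∫v = ⊤`: hard cores, non-`L¹` spikes; Disproof §19
`hardCore_in_scope`): `C⁺` for `v` (unconditional there, `∫v = ⊤ ≠ 0`) gives the crux for `v` in γ-form.
Intended proof: the Jastrow/Dyson-dressed Wagner–Feynman chain of `BECNoCheapMomentum.HardCoreMomentBound`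
(stmt-11844) made per-mode; the line's fragile stub (per-mode dressing error, no printed estimate). A statement
of the proof plan, not a result in print. -/
def HardCoreHalf : Prop :=
  ∀ v : ℝ → ℝ≥0∞, IsRepulsiveFiniteRange v → (∫⁻ x : Space, v ‖x‖) = ⊤ →
    LinearFloorFor v → GroundIRBoundFor v

-- END DEFS

/-! ## §0  The lever: two-sided Markov / Wagner–Feynman bound (finite-dimensional shadow, PROVED) -/

section Wagner

variable {n : Type*} [Fintype n]

open Matrix

/-- Adjoint identity for the dot-product pairing: `⟨ψ, a w⟩ = ⟨aᴴ ψ, w⟩`. [folklore] -/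
theorem star_dot_mulVec (a : Matrix n n ℂ) (ψ w : n → ℂ) :
    star ψ ⬝ᵥ (a *ᵥ w) = star (aᴴ *ᵥ ψ) ⬝ᵥ w := by
  rw [dotProduct_mulVec, star_mulVec, conjTranspose_conjTranspose]

/-- **Two-sided Markov / Wagner–Feynman bound (finite-dimensional shadow).** `H` Hermitian, `H ψ = E ψ`, `a`
any operator. If the hole state `aψ` has mean energy `≥ E + ωm` and the particle state `aᴴψ` has mean energy
`≥ E + ωp`, then `ωm‖aψ‖² + ωp‖aᴴψ‖² ≤ ⟨ψ, [a,[H,aᴴ]] ψ⟩` — the chemical potentials of the two channels CANCEL.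
The algebraic core of `stub_wagnerFeynman`. [Wagner1966; Stringari1995 §2.2 (16); PitaevskiiStringari1991]
(proof verbatim from `IdeatorSketch1.lean` §A, re-checked by triage r1-1) -/
theorem wagner_twoSided (H a : Matrix n n ℂ) (ψ : n → ℂ) (E ωm ωp : ℝ)
    (hH : H.IsHermitian) (hψ : H *ᵥ ψ = (E : ℂ) • ψ)
    (hm : (E + ωm) * (star (a *ᵥ ψ) ⬝ᵥ (a *ᵥ ψ)).re ≤
      (star (a *ᵥ ψ) ⬝ᵥ (H *ᵥ (a *ᵥ ψ))).re)
    (hp : (E + ωp) * (star (aᴴ *ᵥ ψ) ⬝ᵥ (aᴴ *ᵥ ψ)).re ≤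
      (star (aᴴ *ᵥ ψ) ⬝ᵥ (H *ᵥ (aᴴ *ᵥ ψ))).re) :
    ωm * (star (a *ᵥ ψ) ⬝ᵥ (a *ᵥ ψ)).re + ωp * (star (aᴴ *ᵥ ψ) ⬝ᵥ (aᴴ *ᵥ ψ)).re ≤
      (star ψ ⬝ᵥ ((a * (H * aᴴ) - a * (aᴴ * H) - (H * aᴴ * a - aᴴ * (H * a))) *ᵥ ψ)).re := by
  have hHψ : ∀ w : n → ℂ, star ψ ⬝ᵥ (H *ᵥ w) = (E : ℂ) * (star ψ ⬝ᵥ w) := by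
    intro w
    rw [star_dot_mulVec, hH.eq, hψ, star_smul, smul_dotProduct, smul_eq_mul,
      Complex.star_def, Complex.conj_ofReal]
  have h1 : star ψ ⬝ᵥ ((a * (H * aᴴ)) *ᵥ ψ) = star (aᴴ *ᵥ ψ) ⬝ᵥ (H *ᵥ (aᴴ *ᵥ ψ)) := by
    rw [← mulVec_mulVec, ← mulVec_mulVec, star_dot_mulVec]
  have h2 : star ψ ⬝ᵥ ((a * (aᴴ * H)) *ᵥ ψ) = (E : ℂ) * (star (aᴴ *ᵥ ψ) ⬝ᵥ (aᴴ *ᵥ ψ)) := by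
    rw [← mulVec_mulVec, ← mulVec_mulVec, hψ, mulVec_smul, mulVec_smul, dotProduct_smul,
      star_dot_mulVec, smul_eq_mul]
  have h3 : star ψ ⬝ᵥ ((H * aᴴ * a) *ᵥ ψ) = (E : ℂ) * (star (a *ᵥ ψ) ⬝ᵥ (a *ᵥ ψ)) := by
    rw [← mulVec_mulVec, ← mulVec_mulVec, hHψ, star_dot_mulVec aᴴ, conjTranspose_conjTranspose]
  have h4 : star ψ ⬝ᵥ ((aᴴ * (H * a)) *ᵥ ψ) = star (a *ᵥ ψ) ⬝ᵥ (H *ᵥ (a *ᵥ ψ)) := by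
    rw [← mulVec_mulVec, ← mulVec_mulVec, star_dot_mulVec aᴴ, conjTranspose_conjTranspose]
  rw [sub_mulVec, sub_mulVec, sub_mulVec, dotProduct_sub, dotProduct_sub, dotProduct_sub,
    h1, h2, h3, h4]
  simp only [Complex.sub_re, Complex.mul_re, Complex.ofReal_re, Complex.ofReal_im, zero_mul,
    sub_zero]
  rw [add_mul] at hm hp
  linarith

end Wagner

/-! ## §3  Registered stubs (the only `sorry`s of the line)

Stubs 1–3 are VERBATIM items of sibling routes (pooling: they are served there and are not re-staffed from this
crux); stubs 4, 5b, 5c, 6 are this line's own obligations (statements in §2). -/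

/-- **stub_landauSectorBound** — verbatim `BECSectorPoincareTwoScale.LandauSectorBound` = stmt-AtomisticToContinuum-9091
(rank-0 TARGET of that route; XL / open-problem strength: Landau's criterion as a linear `N`-sector floor
`θ√(ρa)|k|` on `|k| ≤ M₀√(ρa)` in the density window `ρ/2 ≤ N/L³ ≤ 2ρ`, hard cores admitted). POOLED: when
stmt-9091 lands, replace this `sorry` by the landed theorem. The HARDEST stub. -/
theorem stub_landauSectorBound : LandauSectorBound := by
  sorry

/-- **stub_energyConvexity** — verbatim `BECSectorPoincareTwoScale.EnergyConvexityWindow` = stmt-AtomisticToContinuum-9094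
(midpoint near-convexity of `N ↦ E₀^per(N,L)` with allowance `ε√(ρa)/L` in the density window). POOLED. -/
theorem stub_energyConvexity : EnergyConvexityWindow := by
  sorry

/-- **stub_zeroMomentumGround** — verbatim `BECNoCheapMomentum.ZeroMomentumGround` = stmt-AtomisticToContinuum-11845
(= `∀ v` integrable admissible, `ZeroMomentumGapFor v`, by `zeroMomentumGround_iff`; XL in Lean, no open
mathematics: compact resolvent + Perron–Frobenius on the torus). POOLED. -/
theorem stub_zeroMomentumGround : ZeroMomentumGround := by
  sorry

/-- **stub_linearFloor_of_landau** (stub 4, S/M, PROVABLE NOW) — see `LinearFloorOfLandau`. -/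
theorem stub_linearFloor_of_landau : LinearFloorOfLandau := by
  sorry

/-- **stub_wagnerFeynman** (stub 5b, the LEAD's stub) — see `WagnerFeynmanBound`. -/
theorem stub_wagnerFeynman : WagnerFeynmanBound := by
  sorry

/-- **stub_transferArith** (stub 5c, M) — see `TransferArith`. -/
theorem stub_transferArith : TransferArith := by
  sorry

/-- **stub_hardCore** (stub 6, L/XL, fragile) — see `HardCoreHalf`. -/
theorem stub_hardCore : HardCoreHalf := by
  sorry

/-! ## §4  Composition (real proof; no `sorry` below this line) -/

/-- `C⁺` from the two pooled spectral/thermodynamic stubs. -/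
theorem linearParticleHoleFloor_of_stubs : LinearParticleHoleFloor :=
  stub_linearFloor_of_landau stub_energyConvexity stub_landauSectorBound

/-- As a by-product the line closes BECNoCheapMomentum's crux stmt-11843 from the same stubs. -/
theorem sectorGapFloor_of_stubs : SectorGapFloor :=
  sectorGapFloor_of_linearParticleHoleFloor linearParticleHoleFloor_of_stubs

/-- The integrable half from stubs 5b, 5c. -/
theorem transfer_of_stubs : Transfer :=
  transfer_of stub_wagnerFeynman stub_transferArith

/-- **The skeleton theorem: the crux `PeriodicIRBound`, concluded BY NAME**, as a closed term over the seven
registered stubs (`periodicIRBound_of_inputs`: unfold the crux to `∀ v admissible, IRBoundFor v`, pass to the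
γ-form, split on `∫v = ⊤` versus `∫v < ⊤`). -/
theorem PeriodicIRBound_of : PeriodicIRBound := by
  have hFloor : LinearParticleHoleFloor := linearParticleHoleFloor_of_stubs
  have hT : Transfer := transfer_of_stubs
  refine Summit.AtomisticToContinuum.BoseEinsteinCondensation.Theorems.PeriodicIRBound.Negative.periodicIRBound_iff.2
    fun v hv => (irBoundFor_iff_ground v).2 ?_
  by_cases htop : (∫⁻ x : Space, v ‖x‖) = ⊤
  · exact stub_hardCore v hv htop (hFloor v hv (ne_of_eq_of_ne htop ENNReal.top_ne_zero))
  · exact hT v hv htop (hFloor v hv) (fun N L hL q hq => stub_zeroMomentumGround v hv htop N L hL q hq)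

end Summit.AtomisticToContinuum.BoseEinsteinCondensation.Cruxes.PeriodicIRBound.LinearPhFloorWagner

end
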